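import Summits.ABC.IUTFork.Cor312MultiradTwist
import HarnessLib

/-!
# REPAIR-CATALOGUE row RC-639 (LANA Rmk 6.2.2, the report's own OPEN POINT «does the input's value-group portion influence the output of the
# raw Thm 3.11 algorithm?») — which horn the TYPED setting realises: the Θ-side OUTPUT of the frozen `Cor312.Setting` (possible images, the
# holomorphic hulls ⁿ˚𝒰_{j,v_ℚ}, `−|log(Θ)|`) does NOT read the q-pilot data; only `−|log(q)|` does (D-0123 (C); KEY RC-639, seat abc-iut-rcat-tst-9)

PROOF-ONLY file (D-0012; no definition, no `Prop` fact; rows RC-639 / RC-130; rung LADDER-ABC:A2). TAKES NO SIDE on [IUTchIII] Cor. 3.12 /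
[IUTchIV] Thm. 1.10, on the LANA authors, or on any author; nothing here asserts abc proved or refuted. Source of the row: Project LANA interim
report `paper:url-7e4c7f9f3efc` (render of record HOME/lit/renders/LANA-url-7e4c7f9f3efc), Rmk. 6.2.2 p. 33 l. 60 – p. 34 l. 9: «the input to
the "raw" Theorem 3.11 algorithm appears to consist solely of the étale-unit BPS, and the value-group part does not seem to affect the
algorithm's result. However, the algorithm's output is a BPS accompanied by the value-group part (of the Θ-pilot, as determined by the
theta-value LGP), and the comparison between this output and the value-group part on the input side (e.g., a q-pilot value-group BPS) is the
subject of Corollary 3.12. On the other hand, it is argued that … (SHE) …; in this sense, the value-group part on the input side may exert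
some influence on the output. Reconciling these points remains a topic of discussion among LANA members.» Two horns (rcat-lit-5 L5-10): (H1)
the output depends on the étale-unit BPS only, the q-pilot value-group datum entering only the comparison (9-1)/Cor. 3.12; (H2) via (SHE) the
input's value-group portion may influence the output.

WHAT IS PROVED — HORN (H1) IS WHAT THE TYPED SETTING REALISES, BY CONGRUENCE. In abc-iut-c312-7's frozen `Cor312.Setting S` the q-pilot enters
through the fields `qData` (the q-pilot data of `†𝒞^⊩_△`, [IUTchIII] Def. 3.8 (i)) and `qRegionOf` (GLUE R2: object ↦ region); the Θ-side
output is built from the column `n`, the hull frames, the Θ-pilot object (`sig`, `split`: the value-group part OF THE Θ-PILOT, «as determined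
by the theta-value LGP») and the GLUE R1 `thetaRegionOf`. For the setting `P` with its q-pilot data REPLACED by any other `(qData′, qRegionOf′)`
(structure update; the two bookkeeping fields re-supplied):
* `possibleImages_replaceQ`, `thetaHull_replaceQ` — the possible images and the holomorphic hulls are unchanged (`rfl`);
* `negLogTheta_replaceQ` — `−|log(Θ)|` is unchanged (abc-iut-w5-d044's congruence `Cor312.Setting.negLogTheta_congr`);
* `qLocal_replaceQ` — while the q-side local term is read off the new data (`rfl`), so `−|log(q)|` and the right-hand side of (9-1)
  (`Repair.CandLana1.H`: «some global possible image has procession-normalised volume `−|log(q)|`») are the ONLY places the q-pilot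
  value-group datum enters.
So, AS TYPED: the output is invariant under the input's q-pilot value-group datum (horn (H1) w.r.t. that datum; concordant with abc-iut-c312-4's
`LanaProcedure.mainGoal_is_the_extra_input` — the value-group comparison enters at step (i) only — and with RC-111's word on RP-M03a
`Repair.CandMochizuki2.H_const`); the output DOES carry the value-group part of the Θ-pilot (through `thetaPilot`/`thetaRegionOf`; at the genuine
bed abc-iut-c312-7's `settingPrVolSharp` reads the Θ-regions off the Θ-ideles `t` realising `P_Θ`, not off the q-ideles `tq`). Horn (H2) has NO
typed counterpart: `thetaRegionOf` is a free GLUE field of the setting (RESIDUAL R1), not a construction from an input BPS, so an influence of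
the input's holomorphic structure on the Θ-regions is UNTESTED(needs typing: a construction `input BPS ↦ thetaRegionOf`). HONEST SCOPE: a
statement about OUR frozen setting; it decides nothing about the report's open point in print or about (SHE); located ≠ adjudicated; typed ≠
proved about print. [cite: LANA2026Report, Rmk. 6.2.2 p. 33–34; §9.2 (9-1) p. 46] [cite: Mochizuki2012, IUTchIII Def. 3.8 (i) p. 112;
Cor. 3.12 p. 173–174] [claim: Mochizuki2012, status: disputed] for every quoted construction.
-/

noncomputable section

namespace Summit.ABC.IUTFork.Repair.RLana91ValueGroupInput

open Thm311 Cor312 Cor312.Setting Literature.IUT.LogThetaLattice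

variable {T : ThetaIndex} {S : Situation T} (P : Cor312.Setting S)
  (qData' : QPilotData P.ObΔ P.N) (qRegionOf' : P.ObΔ → ∀ (j : T.Label) (vQ : T.VQ), Set (S.L.Packet j vQ))
  (hmem : ∀ j vQ, qRegionOf' (qPilotObject qData') j vQ ∈ (P.frame j vQ).Hul)
  (hfin : ∀ j : T.Label, (Function.support fun vQ => (S.D P.n).logvol j vQ (qRegionOf' (qPilotObject qData') j vQ)).Finite)

/-- **The possible images of the Θ-pilot object do not read the q-pilot data**: replacing `(qData, qRegionOf)` by any other q-pilot data and
glue leaves `Cor312.Setting.possibleImages` unchanged (definitionally: they are the ⟨(Ind1) ∪ (Ind2)⟩-translates of the (Ind3)-enlarged Kummer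
image of the Θ-pilot object). [cite: Mochizuki2012, IUTchIII Cor. 3.12 p. 173 l. 49 – p. 174 l. 3] -/
theorem possibleImages_replaceQ (j : T.Label) (vQ : T.VQ) :
    ({ P with qData := qData', qRegionOf := qRegionOf', qRegion_mem := hmem, qSupport_finite := hfin } : Cor312.Setting S).possibleImages
        j vQ = P.possibleImages j vQ :=
  rfl

/-- **The holomorphic hulls `ⁿ˚𝒰_{j,v_ℚ}` do not read the q-pilot data.** [cite: Mochizuki2012, IUTchIII Cor. 3.12 proof p. 174 l. 50–58] -/
theorem thetaHull_replaceQ (j : T.Label) (vQ : T.VQ) :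
    ({ P with qData := qData', qRegionOf := qRegionOf', qRegion_mem := hmem, qSupport_finite := hfin } : Cor312.Setting S).thetaHull j vQ =
      P.thetaHull j vQ :=
  rfl

/-- **`−|log(Θ)|` does not read the q-pilot data** (horn (H1) of LANA Rmk. 6.2.2 AS TYPED, w.r.t. the input's q-pilot value-group datum): the
setting with replaced q-pilot data has the same `−|log(Θ)|` (abc-iut-w5-d044's congruence `Cor312.Setting.negLogTheta_congr`: same column, same
frames, same possible images). [cite: LANA2026Report, Rmk. 6.2.2 p. 33–34] -/
theorem negLogTheta_replaceQ :
    ({ P with qData := qData', qRegionOf := qRegionOf', qRegion_mem := hmem, qSupport_finite := hfin } : Cor312.Setting S).negLogTheta =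
      P.negLogTheta :=
  negLogTheta_congr P _ rfl (fun _ _ => rfl) fun _ _ => rfl

/-- … whereas the q-side local term IS read off the new q-pilot data (so `−|log(q)|`, the printed Statement's left-hand side and the right-hand
side of (9-1) are the only places where the input's q-pilot value-group datum enters the typed setting). [cite: Mochizuki2012, IUTchIII Cor. 3.12
p. 174 l. 4–10] -/
theorem qLocal_replaceQ (j : T.Label) (vQ : T.VQ) :
    ({ P with qData := qData', qRegionOf := qRegionOf', qRegion_mem := hmem, qSupport_finite := hfin } : Cor312.Setting S).qLocal j vQ =
      (S.D P.n).logvol j vQ (qRegionOf' (qPilotObject qData') j vQ) :=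
  rfl

/-- **RC-639 in one term (horn (H1) as typed)**: under ANY replacement of the q-pilot data the Θ-side output (hulls and `−|log(Θ)|`) is
unchanged while the q-side term is the new one — the q-pilot value-group datum is invisible to the output and enters only the comparison.
[cite: LANA2026Report, Rmk. 6.2.2 p. 33–34] -/
theorem output_indep_of_qInput :
    (∀ (j : T.Label) (vQ : T.VQ),
        ({ P with qData := qData', qRegionOf := qRegionOf', qRegion_mem := hmem, qSupport_finite := hfin } : Cor312.Setting S).thetaHull
            j vQ = P.thetaHull j vQ) ∧
      ({ P with qData := qData', qRegionOf := qRegionOf', qRegion_mem := hmem, qSupport_finite := hfin } : Cor312.Setting S).negLogTheta =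
        P.negLogTheta ∧
      (∀ (j : T.Label) (vQ : T.VQ),
        ({ P with qData := qData', qRegionOf := qRegionOf', qRegion_mem := hmem, qSupport_finite := hfin } : Cor312.Setting S).qLocal
            j vQ = (S.D P.n).logvol j vQ (qRegionOf' (qPilotObject qData') j vQ)) :=
  ⟨thetaHull_replaceQ P qData' qRegionOf' hmem hfin, negLogTheta_replaceQ P qData' qRegionOf' hmem hfin,
    qLocal_replaceQ P qData' qRegionOf' hmem hfin⟩

end Summit.ABC.IUTFork.Repair.RLana91ValueGroupInput

end
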